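import Literature.Barriers.RiemannHypothesis.JensenPolynomialsChasse
import Literature.NumberTheory.LFunctions.RiemannHypothesisUpTo101
import Literature.NumberTheory.LFunctions.RiemannHypothesisUpTo2516
import HarnessLib

/-!
# Chasse's verification `GORZ2019_chasse`: the reduction to `RiemannHypothesisUpTo T` and the
# ranges certified inside the tree (`d ≤ 10 201` in the kernel, `d ≤ 6 330 256` compiled)

Barrier catalogue `Literature/Barriers/RiemannHypothesis/` (D-0021), second sibling proof file of
`JensenPolynomials.lean` for the named fact `Literature.Barriers.RiemannHypothesis.GORZ2019_chasse`
(GORZ, PNAS 116 (2019), §1, footnote: "The hyperbolicity for `J^{d,0}_γ(X)` has been confirmed for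
`d ≤ 2·10^17` by Chasse"). `JensenPolynomialsChasse.lean` proves Chasse's theorem
(`jensenPoly_xiTaylorCoeff_splits_of_rh_upTo`: RH for the zeros with `0 < Im ρ < T` makes
`J^{d,0}_γ` hyperbolic for every `d ≤ T²`) and derives `GORZ2019_chasse` from the Platt–Trudgian
fact `platt_trudgian_numerical_rh` (rh.S35, `T = 3 000 175 332 800`, not proved in the tree).
This file

* restates the reduction on the tree's *standard* named hypothesis
  `Literature.NumberTheory.DiophantineGeometry.RiemannHypothesisUpTo T` (`NamedHypotheses.lean`; the
  target of the certificate format `RiemannHypothesisUpToCertificate.lean`):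
  `jensenPoly_xiTaylorCoeff_splits_of_riemannHypothesisUpTo` (`d ≤ T²`) and
  `GORZ2019_chasse_of_riemannHypothesisUpTo` — **`GORZ2019_chasse` follows from
  `RiemannHypothesisUpTo T` for any `T` with `T² ≥ 2·10^17`, e.g. `T = 447 213 596`**
  (`GORZ2019_chasse_of_riemannHypothesisUpTo_447213596`; GORZ's footnote quotes Chasse's range
  `d ≤ 2·10^17`, i.e. `T ≥ √(2·10^17) ≈ 4.47·10^8` in Chasse's theorem);
* records the part of Chasse's range that is **certified inside the tree, unconditionally**:
  - `jensenPoly_xiTaylorCoeff_splits_of_le_10201` — `J^{d,0}_γ` is hyperbolic for every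
    `d ≤ 10 201 = 101²`, from `riemannHypothesisUpTo_hundredOne` (`RiemannHypothesisUpTo101.lean`,
    `29` zeros, `decide +kernel`): **standard axioms only**;
  - `jensenPoly_xiTaylorCoeff_splits_of_le_6330256` — hyperbolic for every
    `d ≤ 6 330 256 = 2516²`, from `riemannHypothesisUpTo_2516` (`RiemannHypothesisUpTo2516.lean`,
    the `2000` zeros of the certified Odlyzko–te Riele computation): standard axioms plus the
    `native_decide` auxiliary axioms of `MertensCertificate/Chunk00–19.lean`, `Top.lean`
    (proposal flag `computational`).

So the kernel certifies GORZ's footnote for `d ≤ 1.02·10^4`, the compiler for `d ≤ 6.33·10^6`; the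
printed range `d ≤ 2·10^17` needs RH to height `4.47·10^8` (`≈ 1.2·10^9` zeros), i.e. the named fact
`platt_trudgian_numerical_rh` or any certificate of `RiemannHypothesisUpTo 447213596`, neither of
which is in reach of a kernel computation; `GORZ2019_chasse_holds` is therefore not proved here.
(For comparison, GORZ §1: "Previous to this paper, hyperbolicity was known for `d ≤ 3` [for all
shifts `n`] by work of Csordas, Norfolk, and Varga, and Dimitrov and Lucas.")

## References

* [GORZPNAS2019] M. Griffin, K. Ono, L. Rolen, D. Zagier, PNAS 116 (2019), §1 and footnote.
* [Chasse2013] M. Chasse, Complex Var. Elliptic Equ. 58 (2013), 875–885, Thm. 1.8 (through GORZ,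
  Farmer 2022 §4, Kim–Lee 2021; not read).
* [KimLee2021] Y.-O. Kim, J. Lee, arXiv:2105.05386, Thm. 4 and Remark (p. 2).
* [OdlyzkoTeRiele1985] A. M. Odlyzko, H. J. J. te Riele, J. reine angew. Math. 357 (1985), §4.2.
* [Edwards1974] H. M. Edwards, *Riemann's Zeta Function*, §6.6 (`N(T)` by Backlund's method).
-/

noncomputable section

open Polynomial

namespace Literature.Barriers.RiemannHypothesis

open Literature.NumberTheory.LFunctions Literature.NumberTheory.DiophantineGeometry

/-! ## The reduction to the named hypothesis `RiemannHypothesisUpTo T` -/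

/-- **Chasse's theorem on the named hypothesis `RiemannHypothesisUpTo`.** If every zero of `ζ`
with `0 < Im ρ ≤ T` is on the critical line (`T > 0`), then `J^{d,0}_γ` splits over `ℝ` for every
`d ≤ T²` (the tree's `jensenPoly_xiTaylorCoeff_splits_of_rh_upTo`, whose hypothesis only asks for
the zeros with `Im ρ < T`).
[cite: Farmer2022, §4] [cite: KimLee2021, Theorem 4 and Remark] [cite: Chasse2013, Theorem 1.8] -/
theorem jensenPoly_xiTaylorCoeff_splits_of_riemannHypothesisUpTo {T : ℝ} (hT : 0 < T)
    (h : RiemannHypothesisUpTo T) {d : ℕ} (hd : (d : ℝ) ≤ T ^ 2) :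
    (jensenPoly xiTaylorCoeff d 0).Splits :=
  jensenPoly_xiTaylorCoeff_splits_of_rh_upTo hT (fun s hs h0 hsT => h s hs h0 hsT.le) hd

/-- **`GORZ2019_chasse` from RH up to any height `T` with `T² ≥ 2·10^17`.**
[cite: GORZPNAS2019, §1 (footnote)] [cite: Chasse2013, Theorem 1.8] -/
theorem GORZ2019_chasse_of_riemannHypothesisUpTo {T : ℝ} (hT : 0 < T)
    (hT2 : (2 * 10 ^ 17 : ℝ) ≤ T ^ 2) (h : RiemannHypothesisUpTo T) : GORZ2019_chasse :=
  fun d hd =>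
    jensenPoly_xiTaylorCoeff_splits_of_riemannHypothesisUpTo hT h
      ((show (d : ℝ) ≤ 2 * 10 ^ 17 by exact_mod_cast hd).trans hT2)

/-- **`GORZ2019_chasse` from `RiemannHypothesisUpTo 447 213 596`** (`447 213 596 = ⌈√(2·10^17)⌉`;
about `1.2·10^9` zeros of `ζ` lie below that height).
[cite: GORZPNAS2019, §1 (footnote)] -/
theorem GORZ2019_chasse_of_riemannHypothesisUpTo_447213596
    (h : RiemannHypothesisUpTo 447213596) : GORZ2019_chasse :=
  GORZ2019_chasse_of_riemannHypothesisUpTo (by norm_num) (by norm_num) h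

/-- Consistency with `JensenPolynomialsChasse.lean`: the Platt–Trudgian fact is literally
`RiemannHypothesisUpTo 3 000 175 332 800` (`platt_trudgian_numerical_rh_iff_riemannHypothesisUpTo`
is `Iff.rfl`), and the general reduction reproduces `GORZ2019_chasse_of_platt_trudgian_numerical_rh`.
[cite: PlattTrudgianBLMS2021, Theorem 1] -/
example (h : platt_trudgian_numerical_rh) : GORZ2019_chasse :=
  GORZ2019_chasse_of_riemannHypothesisUpTo (T := 3000175332800) (by norm_num) (by norm_num) h

/-! ## The ranges certified inside the tree -/

/-- **Chasse's verification for `d ≤ 10 201`, kernel-certified** (standard axioms only): the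
Jensen polynomial `J^{d,0}_γ` of the Taylor coefficients of `(-1+4z²)Λ(½+z)` is hyperbolic for
every `d ≤ 10 201 = 101²`, by Chasse's theorem and the tree's kernel verification of RH up to
height `101` (`riemannHypothesisUpTo_hundredOne`, `N(101) = N₀(101) = 29`).
[cite: GORZPNAS2019, §1 (footnote)] [cite: Chasse2013, Theorem 1.8] [cite: Edwards1974, §6.6] -/
theorem jensenPoly_xiTaylorCoeff_splits_of_le_10201 {d : ℕ} (hd : d ≤ 10201) :
    (jensenPoly xiTaylorCoeff d 0).Splits :=
  jensenPoly_xiTaylorCoeff_splits_of_riemannHypothesisUpTo (T := 101) (by norm_num)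
    riemannHypothesisUpTo_hundredOne
    (by norm_num; exact_mod_cast hd)

/-- **Chasse's verification for `d ≤ 6 330 256`, certified by compiled evaluation**: `J^{d,0}_γ`
is hyperbolic for every `d ≤ 6 330 256 = 2516²`, by Chasse's theorem and RH up to height `2516`
(`riemannHypothesisUpTo_2516`: the `2000` zeros of the tree's certified Odlyzko–te Riele
computation; depends on the `native_decide` auxiliary axioms of that certificate).
[cite: GORZPNAS2019, §1 (footnote)] [cite: Chasse2013, Theorem 1.8] [cite: OdlyzkoTeRiele1985, §4.2 p. 151] -/
theorem jensenPoly_xiTaylorCoeff_splits_of_le_6330256 {d : ℕ} (hd : d ≤ 6330256) :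
    (jensenPoly xiTaylorCoeff d 0).Splits :=
  jensenPoly_xiTaylorCoeff_splits_of_riemannHypothesisUpTo (T := 2516) (by norm_num)
    riemannHypothesisUpTo_2516
    (by norm_num; exact_mod_cast hd)

/-- The certified fraction of GORZ's footnote, as one statement: `GORZ2019_chasse` restricted to
`d ≤ 6 330 256` holds (compiled evaluation; `d ≤ 10 201` in the kernel alone).
[cite: GORZPNAS2019, §1 (footnote)] -/
theorem GORZ2019_chasse_upTo_6330256 :
    ∀ d : ℕ, d ≤ 6330256 → (jensenPoly xiTaylorCoeff d 0).Splits :=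
  fun _ hd => jensenPoly_xiTaylorCoeff_splits_of_le_6330256 hd

end Literature.Barriers.RiemannHypothesis
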